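import Mathlib
import Literature.MathematicalPhysics.QuantumFieldTheory.Balaban1983to89.B5Ineq167UpperZd
import Literature.MathematicalPhysics.QuantumFieldTheory.Balaban1983to89.B5Hk165TranslZd

/-!
# Bałaban [B5] p.29, the sentence between (1.66) and (1.67), scalar, whole lattice `ℤ^d`: the MULTIPLIER of the
# scalar `Δ_k` is bounded below and above by `d`-only constants times the Dirichlet symbol —
# `ω(p) ≤ σ(p) ≤ γ₁(d)·ω(p)` for every momentum `p ∈ ℝ^d`

**Source (verbatim; the quotation LOCATES the statement — nothing printed is used as a hypothesis).**
[B5] = T. Bałaban, *Propagators and renormalization transformations for lattice gauge theories. I*, Commun. Math.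
Phys. **95** (1984) 17–40 [`Balaban1984PropagatorsI`], p. 29 [PDF 13] (render
`b2b-balaban-ref1/pages/1984-cmp95-propagators-rt-I/…-p013-x2.png`, read as an image by the author of this file):
«Using formulas (1.60) or (1.63) we obtain the following expression ⟨B, Δ_kB⟩ = […] = ⟨∂₁B, σ_k∂₁B⟩ = ½ Σ_{μ,ν}
(2π)^{−d} ∫dp′ […] |(∂₁B)~_{μν}(p′)|². (1.66)  The function under the integral is bounded from below and above by
positive constants γ₀, γ₁ dependent on d only, so we have γ₀⟨∂₁B, ∂₁B⟩ ≦ ⟨B, Δ_kB⟩ ≦ γ₁⟨∂₁B, ∂₁B⟩. (1.67)»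
(the bracketed ellipses elide the printed operator and Fourier multiplier, which are not used here).  The print
argues MULTIPLIER ⇒ FORM; no proof of the multiplier bounds and no value of `γ₀`, `γ₁` are printed.

**What is proved here (zero `sorry`; every `d`, every block side `n + 1 ≥ 1`, every `a > 0`).**  Objects: the
scalar whole-lattice line of this seat's nodes 3–11 and g8-1 (`B6QGQLower276` … `B5Hk165TranslZd`,
`B5Ineq167UpperZd`): the coarse action kernel `actionKer n a y″ y = (Q′G′Q′*)⁻¹(y″,y) − aδ` of node 8 (the scalar
`Δ_k` of (1.65), `energy_HB_eq'`), a CONVOLUTION kernel by node 11 (`Kinv_eq_col_zero`).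
* §1 [folklore] `kappa n a z = Δ^{scalar}(z, 0)`, `actionKer_eq_kappa` / `actionForm_eq_kappa` (the action form is
  the convolution form `Σ B(y″)B(y)κ(y″ − y)`), and **`summable_abs_kappa`: `κ ∈ ℓ¹(ℤ^d)`** from node 5's
  Combes–Thomas entry bound `abs_Kinv_le` and the lattice exponential sums `summable_expX`.
* §2 [folklore] the SYMBOL **`sigma n a p = Σ'_z κ(z) cos(p·z)`** (`p ∈ ℝ^d`, `phase p z = Σ_μ p_μ z_μ`), absolutely
  convergent (`summable_term`), bounded by `‖κ‖_{ℓ¹}` (`abs_sigma_le`) and continuous (`continuous_sigma`); the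
  Dirichlet symbol **`omega p = Σ_μ (2 − 2cos p_μ)`** of `⟨∂₁B, ∂₁B⟩ = energy B`, `ω ≤ 4d` (`omega_le`).
* §3 [folklore] the TRIGONOMETRIC TEST PAIR on the box `Λ = B m 0 = {0,…,m}^d`: `Cf = 1_Λ cos(p·y)`,
  `Sf = 1_Λ sin(p·y)`; because `cos·cos′ + sin·sin′ = cos(difference)` (`Cf_mul_add_Sf_mul`, `step_sq_add`) the SUM
  of the two actions / energies has no oscillatory remainder: **`action_pair`: `⟨C,Δ_kC⟩ + ⟨S,Δ_kS⟩ =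
  Σ'_z κ(z)cos(p·z)·c_Λ(z)`** and **`energy_pair`: `energy C + energy S = Σ_μ (2(m+1)^d − 2cos(p_μ)c_Λ(e_μ))`**,
  where `c_Λ(z) = cnt m z = #{y ∈ Λ : y + z ∈ Λ}` is the pair-correlation count (`sum_sum_sub_eq`: re-indexing a
  translation-invariant double box sum by the difference variable); `pair_sandwich` = the kernel-proved two-sided
  (1.67) of nodes 9 / g8-1 (`ineq167_scalar`) applied to the pair and added.
* §4 [folklore] the THERMODYNAMIC LIMIT: `(m + 1 − 2K)^d ≤ c_Λ(z) ≤ (m+1)^d` (`cnt_ge` by the sub-box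
  `K·𝟙 + {0,…,m−2K}^d`, `K = Σ_μ|z_μ|`; `cnt_le`), so `c_Λ(z)/(m+1)^d → 1` (`tendsto_cnt_div`); Tannery's theorem
  (Mathlib `tendsto_tsum_of_dominated_convergence`, dominated by `|κ| ∈ ℓ¹`) gives **`tendsto_action_pair`:
  `A_m/(m+1)^d → σ(p)`**, and `tendsto_energy_pair`: `E_m/(m+1)^d → ω(p)`.
* §5 **`sigma_bounds` — THE MULTIPLIER BOUNDS: `ω(p) ≤ σ_{n,a}(p) ≤ γ₁(d)·ω(p)` for EVERY `p ∈ ℝ^d`**, `γ₀ = 1`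
  (node 9), `γ₁(d) = B5Ineq167UpperZd.gamma1 d = 2 + 8d²·36^d` (node g8-1), uniformly in `n` and `a > 0`
  (`le_of_tendsto_of_tendsto'` on the sandwiched, normalised pair); corollaries `sigma_nonneg`, `sigma_le`
  (`σ ≤ 4dγ₁`), **`sigma_zero`: `σ(0) = 0`** and the MASS SUM RULE **`tsum_Kinv_col`:
  `Σ'_{z ∈ ℤ^d} (Q′G′Q′*)⁻¹(z, 0) = a`** (`tsum_kappa`: `Σ'_z κ(z) = 0` — the scalar `Δ_k` annihilates constants in
  the `ℓ¹`-kernel sense); the printed shape «∃ γ₀, γ₁ > 0 depending on d only» as the closed statement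
  `sigma_bounds_exists`.

RELATION TO THE TREE (by name; nothing is imported from `Beta/` or from the torus line).  Nodes 9 and g8-1
(`B5Ineq167LowerZd.ineq167_lower_scalar`, `B5Ineq167UpperZd.ineq167_upper_scalar`) are the FORM inequality (1.67)
for the scalar `ℤ^d` objects; this file is its MULTIPLIER (symbol) reading — the direction FORM ⇒ MULTIPLIER,
opposite to the paper's.  `B5Bounds167Lattice` (pv15) DEFINES the form by the printed multiplier of (1.66) on a
torus; `Beta.Ineq167Operator` / `Beta.Ineq167OperatorUpper` (an5) treat the genuine vector operator on finite tori
by finite Fourier analysis; `B5Hk165TranslZd` (node 11) is the structural prerequisite used here (convolution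
kernel).  The torus (1.65)↔(1.66) dictionary for the typed vector `H_k` (b05-g12, claim HK163-FORM166) is a
different object and is not touched.

HONEST SCOPE.  (i) SCALAR analogue (plain block means; no gauge condition `R∂*A = 0`, no vector indices);
(ii) WHOLE lattice `ℤ^d`; the symbol is the `ℓ¹`-trigonometric series of the kernel, evaluated pointwise on `ℝ^d`
— the Parseval / momentum-integral REPRESENTATION `⟨B, Δ_kB⟩ = (2π)^{−d}∫σ(p)|B̂(p)|²dp` of (1.66) is NOT
formalised here (only its kernel side `actionForm_eq_kappa`), nor is the explicit printed multiplier of (1.66);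
(iii) `γ₀ = 1`, `γ₁(d) = 2 + 8d²·36^d` are what nodes 9 / g8-1 give, far from optimal; (iv) nothing here is the
continuum limit, the torus statement, or progress on any summit: value = kernel discharge of the multiplier
reading of one printed-unproved sentence in the scalar infinite-volume setting.

ABSOLUTE-RULE CENSUS: every theorem below is proved outright from the tree modules named above and Mathlib
(sorry-free; axioms `propext`, `Classical.choice`, `Quot.sound` only); no quoted statement is used as a
hypothesis; the hypotheses of the headline theorems are `0 < a` only.  Unit `b2b-balaban-pv23-g8` (surge node
prover #23, gen 8; journal claim B5-166-SYMBOL-SCALAR-ZD); value = kernel discharge (scalar, infinite volume),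
NOT summit progress.
-/

namespace Literature.MathematicalPhysics.QuantumFieldTheory.Balaban1983to89.B5Ineq167SymbolZd

open Finset Real Filter Topology
open B6QGQLower276 B6QGQDecay237 B5Hk103ScalarZd B5Hk103Unique B5Hk103Minimizer B5Hk165ActionZd
  B5Ineq167LowerZd B5Ineq167UpperZd B5Hk165TranslZd

noncomputable section

variable {d : ℕ}

/-! ## §1  The convolution kernel `κ(z) = Δ^{scalar}(z, 0)` of the scalar action and its absolute summability
[folklore over nodes 5, 8, 11] -/

/-- **The convolution kernel of the scalar `Δ_k` on `ℤ^d`**: `κ(z) = Δ^{scalar}(z, 0) = (Q′G′Q′*)⁻¹(z, 0) − a·δ_{z0}`.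
[folklore] -/
def kappa (n : ℕ) (a : ℝ) (z : X d) : ℝ := actionKer n a z 0

/-- `Δ^{scalar}(y″, y) = κ(y″ − y)` (node 11: `Kinv_eq_col_zero`). [folklore] -/
theorem actionKer_eq_kappa (n : ℕ) {a : ℝ} (ha : 0 < a) (y'' y : X d) :
    actionKer n a y'' y = kappa n a (y'' - y) := by
  unfold kappa actionKer
  rw [Kinv_eq_col_zero n ha y'' y]
  by_cases h : y'' = y
  · simp [h]
  · simp [h, sub_eq_zero.not.mpr h]

/-- **The coarse action form is a convolution form**: `⟨B, Δ_kB⟩ = Σ_{y″,y ∈ T} B(y″)B(y)κ(y″ − y)`. [folklore] -/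
theorem actionForm_eq_kappa (n : ℕ) {a : ℝ} (ha : 0 < a) (T : Finset (X d)) (Bf : X d → ℝ) :
    actionForm n a T Bf = ∑ y'' ∈ T, ∑ y ∈ T, Bf y'' * Bf y * kappa n a (y'' - y) := by
  unfold actionForm
  exact Finset.sum_congr rfl fun y'' _ => Finset.sum_congr rfl fun y _ => by rw [actionKer_eq_kappa n ha]

/-- Entry bound: `|κ(z)| ≤ c_inv e^{−δ_inv|z|_∞} + a·δ_{z0}` (node 5: `abs_Kinv_le`). [folklore] -/
theorem abs_kappa_le (n : ℕ) {a : ℝ} (ha : 0 < a) (z : X d) :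
    |kappa n a z| ≤ cInv d a * Real.exp (-(deltaInv d a * dist (0 : X d) z)) + (if z = 0 then a else 0) := by
  unfold kappa actionKer
  have h1 := abs_Kinv_le n ha z 0
  rw [dist_comm] at h1
  by_cases hz : z = 0
  · rw [if_pos hz, if_pos hz, mul_one]
    calc |Kinv n a z 0 - a| ≤ |Kinv n a z 0| + |a| := abs_sub _ _
      _ ≤ cInv d a * Real.exp (-(deltaInv d a * dist (0 : X d) z)) + a := by
          rw [abs_of_pos ha]; exact add_le_add h1 le_rfl
  · rw [if_neg hz, if_neg hz, mul_zero, sub_zero, add_zero]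
    exact h1

/-- **`κ ∈ ℓ¹(ℤ^d)`**. [folklore] -/
theorem summable_abs_kappa (n : ℕ) {a : ℝ} (ha : 0 < a) : Summable fun z : X d => |kappa n a z| :=
  Summable.of_nonneg_of_le (fun _ => abs_nonneg _) (abs_kappa_le n ha)
    (((summable_expX (deltaInv_pos d ha) (0 : X d)).mul_left (cInv d a)).add (hasSum_ite_eq (0 : X d) a).summable)

/-- `κ` is summable. [folklore] -/
theorem summable_kappa (n : ℕ) {a : ℝ} (ha : 0 < a) : Summable (kappa (d := d) n a) :=
  (summable_abs_kappa n ha).of_abs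

/-! ## §2  The symbol `σ(p) = Σ_z κ(z) cos(p·z)` and the Dirichlet symbol `ω(p) = Σ_μ (2 − 2cos p_μ)` [folklore] -/

/-- The phase `p·z = Σ_μ p_μ z_μ` (`p ∈ ℝ^d`, `z ∈ ℤ^d`). [folklore] -/
def phase (p : Fin d → ℝ) (z : X d) : ℝ := ∑ μ, p μ * (z μ : ℝ)

/-- `p·(y − z) = p·y − p·z`. [folklore] -/
theorem phase_sub (p : Fin d → ℝ) (y z : X d) : phase p (y - z) = phase p y - phase p z := by
  unfold phase
  rw [← Finset.sum_sub_distrib]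
  exact Finset.sum_congr rfl fun μ _ => by rw [Pi.sub_apply, Int.cast_sub, mul_sub]

/-- `p·(y + z) = p·y + p·z`. [folklore] -/
theorem phase_add (p : Fin d → ℝ) (y z : X d) : phase p (y + z) = phase p y + phase p z := by
  unfold phase
  rw [← Finset.sum_add_distrib]
  exact Finset.sum_congr rfl fun μ _ => by rw [Pi.add_apply, Int.cast_add, mul_add]

/-- `p·e_μ = p_μ`. [folklore] -/
theorem phase_e (p : Fin d → ℝ) (μ : Fin d) : phase p (e μ) = p μ := by
  unfold phase
  rw [Finset.sum_eq_single μ]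
  · rw [e_apply_self, Int.cast_one, mul_one]
  · intro ν _ hν
    rw [e_apply_ne hν, Int.cast_zero, mul_zero]
  · intro h; exact absurd (Finset.mem_univ μ) h

/-- `p·0 = 0`. [folklore] -/
theorem phase_zero (p : Fin d → ℝ) : phase p (0 : X d) = 0 := by
  unfold phase; simp

/-- `0·z = 0`. [folklore] -/
theorem phase_zero_left (z : X d) : phase (0 : Fin d → ℝ) z = 0 := by
  unfold phase; simp

/-- **The symbol of the scalar `Δ_k`**: `σ(p) = Σ'_{z ∈ ℤ^d} κ(z) cos(p·z)`, an absolutely convergent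
trigonometric series. [folklore] -/
def sigma (n : ℕ) (a : ℝ) (p : Fin d → ℝ) : ℝ := ∑' z : X d, kappa n a z * Real.cos (phase p z)

/-- **The symbol of the unit-lattice Dirichlet form** `⟨∂₁B, ∂₁B⟩`: `ω(p) = Σ_μ (2 − 2cos p_μ) = Σ_μ |e^{ip_μ} − 1|²`.
[folklore] -/
def omega (p : Fin d → ℝ) : ℝ := ∑ μ : Fin d, (2 - 2 * Real.cos (p μ))

/-- `ω(p) ≤ 4d`. [folklore] -/
theorem omega_le (p : Fin d → ℝ) : omega p ≤ 4 * d := by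
  unfold omega
  calc ∑ μ : Fin d, (2 - 2 * Real.cos (p μ)) ≤ ∑ _μ : Fin d, (4 : ℝ) :=
        Finset.sum_le_sum fun μ _ => by linarith [Real.neg_one_le_cos (p μ)]
    _ = 4 * d := by rw [Finset.sum_const, Finset.card_univ, Fintype.card_fin, nsmul_eq_mul, mul_comm]

/-- The terms of `σ` are dominated by `|κ|`. [folklore] -/
theorem abs_term_le (n : ℕ) (a : ℝ) (p : Fin d → ℝ) (z : X d) :
    |kappa n a z * Real.cos (phase p z)| ≤ |kappa n a z| := by
  rw [abs_mul]
  exact mul_le_of_le_one_right (abs_nonneg _) (Real.abs_cos_le_one _)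

/-- The trigonometric series of `σ` converges absolutely. [folklore] -/
theorem summable_term (n : ℕ) {a : ℝ} (ha : 0 < a) (p : Fin d → ℝ) :
    Summable fun z : X d => kappa n a z * Real.cos (phase p z) :=
  (Summable.of_nonneg_of_le (fun _ => abs_nonneg _) (abs_term_le n a p) (summable_abs_kappa n ha)).of_abs

/-- `|σ(p)| ≤ ‖κ‖_{ℓ¹}`. [folklore] -/
theorem abs_sigma_le (n : ℕ) {a : ℝ} (ha : 0 < a) (p : Fin d → ℝ) :
    |sigma n a p| ≤ ∑' z : X d, |kappa n a z| := by
  unfold sigma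
  have h1 : ‖∑' z : X d, kappa n a z * Real.cos (phase p z)‖ ≤ ∑' z : X d, ‖kappa n a z * Real.cos (phase p z)‖ :=
    norm_tsum_le_tsum_norm (summable_term n ha p).norm
  simp only [Real.norm_eq_abs] at h1
  exact h1.trans ((summable_term n ha p).abs.tsum_le_tsum (abs_term_le n a p) (summable_abs_kappa n ha))

/-- **`σ` is continuous on `ℝ^d`** (uniformly convergent trigonometric series). [folklore] -/
theorem continuous_sigma (n : ℕ) {a : ℝ} (ha : 0 < a) : Continuous (sigma (d := d) n a) := by
  unfold sigma
  refine continuous_tsum (fun z => ?_) (summable_abs_kappa n ha) (fun z p => ?_)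
  · unfold phase
    exact continuous_const.mul (Real.continuous_cos.comp
      (continuous_finsetSum _ fun μ _ => (continuous_apply μ).mul continuous_const))
  · rw [Real.norm_eq_abs]; exact abs_term_le n a p z

/-! ## §3  Boxes `Λ_m = {0,…,m}^d`, the trigonometric test fields, and the pair-correlation count [folklore] -/

/-- Coordinates in `[0, m]` put a point in the box `B m 0`. [folklore] -/
theorem mem_B_zero_of_bounds {m : ℕ} {q : X d} (h : ∀ μ, 0 ≤ q μ ∧ q μ ≤ m) : q ∈ B m (0 : X d) := by
  rw [mem_B]
  funext μ
  show q μ / side m = 0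
  rw [side]
  exact Int.ediv_eq_zero_of_lt (h μ).1 (by have := (h μ).2; omega)

/-- The indicator of the box. [folklore] -/
def ind (m : ℕ) (y : X d) : ℝ := if y ∈ B m (0 : X d) then 1 else 0

/-- `1_Λ = 1` on `Λ`. [folklore] -/
theorem ind_of_mem {m : ℕ} {y : X d} (h : y ∈ B m (0 : X d)) : ind m y = 1 := if_pos h
/-- `1_Λ = 0` off `Λ`. [folklore] -/
theorem ind_of_not_mem {m : ℕ} {y : X d} (h : y ∉ B m (0 : X d)) : ind m y = 0 := if_neg h
/-- `0 ≤ 1_Λ`. [folklore] -/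
theorem ind_nonneg (m : ℕ) (y : X d) : 0 ≤ ind m y := by
  unfold ind; split_ifs <;> norm_num
/-- `1_Λ ≤ 1`. [folklore] -/
theorem ind_le_one (m : ℕ) (y : X d) : ind m y ≤ 1 := by
  unfold ind; split_ifs <;> norm_num
/-- `1_Λ·1_Λ = 1_Λ`. [folklore] -/
theorem ind_mul_self (m : ℕ) (y : X d) : ind m y * ind m y = ind m y := by
  unfold ind; split_ifs <;> norm_num

/-- The cosine test field `1_Λ(y) cos(p·y)`. [folklore] -/
def Cf (m : ℕ) (p : Fin d → ℝ) (y : X d) : ℝ := ind m y * Real.cos (phase p y)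

/-- The sine test field `1_Λ(y) sin(p·y)`. [folklore] -/
def Sf (m : ℕ) (p : Fin d → ℝ) (y : X d) : ℝ := ind m y * Real.sin (phase p y)

/-- The cosine test field vanishes off the box. [folklore] -/
theorem Cf_zero {m : ℕ} (p : Fin d → ℝ) {y : X d} (h : y ∉ B m (0 : X d)) : Cf m p y = 0 := by
  unfold Cf; rw [ind_of_not_mem h, zero_mul]

/-- The sine test field vanishes off the box. [folklore] -/
theorem Sf_zero {m : ℕ} (p : Fin d → ℝ) {y : X d} (h : y ∉ B m (0 : X d)) : Sf m p y = 0 := by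
  unfold Sf; rw [ind_of_not_mem h, zero_mul]

/-- **The pair-correlation count** `c_Λ(z) = #{y ∈ Λ : y + z ∈ Λ}` (as a real number). [folklore] -/
def cnt (m : ℕ) (z : X d) : ℝ := ∑ y ∈ B m (0 : X d), ind m (y + z)

/-- `0 ≤ c_Λ(z)`. [folklore] -/
theorem cnt_nonneg (m : ℕ) (z : X d) : 0 ≤ cnt m z := Finset.sum_nonneg fun _ _ => ind_nonneg m _

/-- `c_Λ(z) ≤ #Λ = (m+1)^d`. [folklore] -/
theorem cnt_le (m : ℕ) (z : X d) : cnt m z ≤ ((m : ℝ) + 1) ^ d := by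
  unfold cnt
  calc ∑ y ∈ B m (0 : X d), ind m (y + z) ≤ ∑ _y ∈ B m (0 : X d), (1 : ℝ) :=
        Finset.sum_le_sum fun y _ => ind_le_one m _
    _ = ((m : ℝ) + 1) ^ d := by rw [sum_B_const, mul_one]

/-- **The trigonometric identity behind the test**: `cos·cos′ + sin·sin′ = cos(difference)`, pointwise for the
two test fields: `C(y″)C(y) + S(y″)S(y) = 1_Λ(y″)1_Λ(y) cos(p·(y″ − y))`. [folklore] -/
theorem Cf_mul_add_Sf_mul (m : ℕ) (p : Fin d → ℝ) (y'' y : X d) :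
    Cf m p y'' * Cf m p y + Sf m p y'' * Sf m p y = ind m y'' * ind m y * Real.cos (phase p (y'' - y)) := by
  unfold Cf Sf
  rw [phase_sub, Real.cos_sub]
  ring

/-- `(C(y) − C(y′))² + (S(y) − S(y′))² = 1_Λ(y) + 1_Λ(y′) − 2·1_Λ(y)1_Λ(y′)cos(p·(y − y′))`. [folklore] -/
theorem step_sq_add (m : ℕ) (p : Fin d → ℝ) (y y' : X d) :
    (Cf m p y - Cf m p y') ^ 2 + (Sf m p y - Sf m p y') ^ 2
      = ind m y + ind m y' - 2 * (ind m y * ind m y') * Real.cos (phase p (y - y')) := by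
  unfold Cf Sf
  rw [phase_sub, Real.cos_sub]
  have h1 := Real.sin_sq_add_cos_sq (phase p y)
  have h2 := Real.sin_sq_add_cos_sq (phase p y')
  have i1 := ind_mul_self m y
  have i2 := ind_mul_self m y'
  linear_combination (ind m y) ^ 2 * h1 + (ind m y') ^ 2 * h2 + i1 + i2

/-- Re-indexing a translation-invariant double sum over the box by the difference variable:
`Σ'_z g(z)·1_Λ(y + z) = Σ_{y″ ∈ Λ} g(y″ − y)`. [folklore] -/
theorem tsum_mul_ind_shift (m : ℕ) (g : X d → ℝ) (y : X d) :
    ∑' z : X d, g z * ind m (y + z) = ∑ y'' ∈ B m (0 : X d), g (y'' - y) := by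
  rw [tsum_eq_sum (s := (B m (0 : X d)).image fun w => w - y)]
  · rw [Finset.sum_image fun w _ w' _ (h : w - y = w' - y) => sub_left_injective h]
    exact Finset.sum_congr rfl fun w hw => by rw [add_sub_cancel, ind_of_mem hw, mul_one]
  · intro z hz
    have : y + z ∉ B m (0 : X d) := by
      intro h
      exact hz (Finset.mem_image.2 ⟨y + z, h, add_sub_cancel_left y z⟩)
    rw [ind_of_not_mem this, mul_zero]

/-- `Σ_{y″ ∈ Λ} Σ_{y ∈ Λ} g(y″ − y) = Σ'_z g(z)·c_Λ(z)`. [folklore] -/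
theorem sum_sum_sub_eq (m : ℕ) (g : X d → ℝ) :
    ∑ y'' ∈ B m (0 : X d), ∑ y ∈ B m (0 : X d), g (y'' - y) = ∑' z : X d, g z * cnt m z := by
  have hs : ∀ y ∈ B m (0 : X d), Summable fun z : X d => g z * ind m (y + z) := by
    intro y _
    refine summable_of_ne_finset_zero (s := (B m (0 : X d)).image fun w => w - y) fun z hz => ?_
    have : y + z ∉ B m (0 : X d) := by
      intro h
      exact hz (Finset.mem_image.2 ⟨y + z, h, add_sub_cancel_left y z⟩)
    rw [ind_of_not_mem this, mul_zero]
  unfold cnt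
  simp_rw [Finset.mul_sum]
  rw [Summable.tsum_finsetSum hs, Finset.sum_comm]
  exact Finset.sum_congr rfl fun y _ => (tsum_mul_ind_shift m g y).symm

/-- **The action of the test pair**: `⟨C, Δ_kC⟩ + ⟨S, Δ_kS⟩ = Σ'_z κ(z) cos(p·z) c_Λ(z)` — no oscillatory
remainder, because `cos cos′ + sin sin′ = cos(· − ·)`. [folklore] -/
theorem action_pair (n : ℕ) {a : ℝ} (ha : 0 < a) (m : ℕ) (p : Fin d → ℝ) :
    actionForm n a (B m 0) (Cf m p) + actionForm n a (B m 0) (Sf m p)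
      = ∑' z : X d, kappa n a z * Real.cos (phase p z) * cnt m z := by
  rw [actionForm_eq_kappa n ha, actionForm_eq_kappa n ha, ← Finset.sum_add_distrib]
  rw [← sum_sum_sub_eq m (fun z => kappa n a z * Real.cos (phase p z))]
  refine Finset.sum_congr rfl fun y'' hy'' => ?_
  rw [← Finset.sum_add_distrib]
  refine Finset.sum_congr rfl fun y hy => ?_
  have h := Cf_mul_add_Sf_mul m p y'' y
  rw [ind_of_mem hy'', ind_of_mem hy, one_mul, one_mul] at h
  calc Cf m p y'' * Cf m p y * kappa n a (y'' - y) + Sf m p y'' * Sf m p y * kappa n a (y'' - y)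
      = (Cf m p y'' * Cf m p y + Sf m p y'' * Sf m p y) * kappa n a (y'' - y) := by ring
    _ = kappa n a (y'' - y) * Real.cos (phase p (y'' - y)) := by rw [h]; ring

/-- The test fields are finitely supported, hence square summable with square-summable gradients. [folklore] -/
theorem summable_Cf_sq (m : ℕ) (p : Fin d → ℝ) : Summable fun y : X d => Cf m p y ^ 2 :=
  summable_sq_of_support (T := B m 0) fun _ hy => Cf_zero p hy

/-- The sine test field is square summable. [folklore] -/
theorem summable_Sf_sq (m : ℕ) (p : Fin d → ℝ) : Summable fun y : X d => Sf m p y ^ 2 :=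
  summable_sq_of_support (T := B m 0) fun _ hy => Sf_zero p hy

/-- `1_Λ` is summable. [folklore] -/
theorem summable_ind (m : ℕ) : Summable (ind (d := d) m) :=
  summable_of_ne_finset_zero (s := B m (0 : X d)) fun _ hy => ind_of_not_mem hy

/-- `Σ' 1_Λ = (m+1)^d`. [folklore] -/
theorem tsum_ind (m : ℕ) : ∑' y : X d, ind m y = ((m : ℝ) + 1) ^ d := by
  rw [tsum_eq_sum (s := B m (0 : X d)) fun y hy => ind_of_not_mem hy]
  rw [Finset.sum_congr rfl fun y hy => ind_of_mem hy, sum_B_const, mul_one]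

/-- `1_Λ(y)1_Λ(y + v)` is summable in `y`. [folklore] -/
theorem summable_ind_mul_shift (m : ℕ) (v : X d) : Summable fun y : X d => ind m y * ind m (y + v) :=
  summable_of_ne_finset_zero (s := B m (0 : X d)) fun y hy => by rw [ind_of_not_mem hy, zero_mul]

/-- `Σ'_y 1_Λ(y)1_Λ(y + v) = c_Λ(v)`. [folklore] -/
theorem tsum_ind_mul_shift (m : ℕ) (v : X d) : ∑' y : X d, ind m y * ind m (y + v) = cnt m v := by
  rw [tsum_eq_sum (s := B m (0 : X d)) fun y hy => by rw [ind_of_not_mem hy, zero_mul]]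
  unfold cnt
  exact Finset.sum_congr rfl fun y hy => by rw [ind_of_mem hy, one_mul]

/-- **The energy of the test pair**: `energy C + energy S = Σ_μ (2(m+1)^d − 2cos(p_μ)·c_Λ(e_μ))`. [folklore] -/
theorem energy_pair (m : ℕ) (p : Fin d → ℝ) :
    energy (Cf m p) + energy (Sf m p)
      = ∑ μ : Fin d, (2 * ((m : ℝ) + 1) ^ d - 2 * Real.cos (p μ) * cnt m (e μ)) := by
  unfold energy
  rw [← Finset.sum_add_distrib]
  refine Finset.sum_congr rfl fun μ _ => ?_
  have hC := summable_grad_sq (summable_Cf_sq m p) μ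
  have hS := summable_grad_sq (summable_Sf_sq m p) μ
  rw [← hC.tsum_add hS]
  have hpt : ∀ y : X d, (Cf m p y - Cf m p (y + e μ)) ^ 2 + (Sf m p y - Sf m p (y + e μ)) ^ 2
      = ind m y + ind m (y + e μ) - 2 * Real.cos (p μ) * (ind m y * ind m (y + e μ)) := by
    intro y
    rw [step_sq_add, show y - (y + e μ) = -e μ by abel, show phase p (-e μ) = -phase p (e μ) by
      rw [show -e μ = (0 : X d) - e μ by abel, phase_sub, phase_zero, zero_sub], Real.cos_neg, phase_e]
    ring
  rw [tsum_congr hpt]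
  have h1 := summable_ind (d := d) m
  have h2 : Summable fun y : X d => ind m (y + e μ) := summable_shift h1 (e μ)
  have h3 := (summable_ind_mul_shift m (e μ)).mul_left (2 * Real.cos (p μ))
  rw [(h1.add h2).tsum_sub h3, h1.tsum_add h2, tsum_mul_left, tsum_ind_mul_shift, tsum_shift (ind m) (e μ),
    tsum_ind]
  ring

/-- **The sandwich for the test pair** from the kernel-proved two-sided (1.67) (node 9 + node g8-1):
`E ≤ A ≤ γ₁(d)·E` with `A`, `E` the action and the energy of the pair. [folklore] -/
theorem pair_sandwich (n : ℕ) {a : ℝ} (ha : 0 < a) (m : ℕ) (p : Fin d → ℝ) :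
    energy (Cf m p) + energy (Sf m p)
        ≤ actionForm n a (B m 0) (Cf m p) + actionForm n a (B m 0) (Sf m p) ∧
      actionForm n a (B m 0) (Cf m p) + actionForm n a (B m 0) (Sf m p)
        ≤ gamma1 d * (energy (Cf m p) + energy (Sf m p)) := by
  have hC := ineq167_scalar n ha (B m 0) (Cf m p) fun _ hy => Cf_zero p hy
  have hS := ineq167_scalar n ha (B m 0) (Sf m p) fun _ hy => Sf_zero p hy
  constructor
  · linarith [hC.1, hS.1]
  · linarith [hC.2, hS.2]

/-! ## §4  The thermodynamic limit of the test: `c_Λ(z)/(m+1)^d → 1`, Tannery's theorem [folklore] -/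

/-- `K(z) = Σ_μ |z_μ|` dominates every coordinate of `z`. [folklore] -/
def K1 (z : X d) : ℕ := ∑ μ, (z μ).natAbs

/-- `|z_μ| ≤ K(z)`. [folklore] -/
theorem natAbs_le_K1 (z : X d) (μ : Fin d) : (z μ).natAbs ≤ K1 z :=
  Finset.single_le_sum (f := fun ν => (z ν).natAbs) (fun _ _ => Nat.zero_le _) (Finset.mem_univ μ)

/-- **Lower bound for the pair-correlation count**: the sub-box `K·𝟙 + {0,…,m−2K}^d` is counted, so
`(m + 1 − 2K)^d ≤ c_Λ(z)` whenever `2K ≤ m`, `K = Σ_μ |z_μ|`. [folklore] -/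
theorem cnt_ge (m : ℕ) (z : X d) (hK : 2 * K1 z ≤ m) : ((m : ℝ) + 1 - 2 * K1 z) ^ d ≤ cnt m z := by
  set K := K1 z with hKdef
  let kv : X d := fun _ => (K : ℤ)
  let Λ' : Finset (X d) := (B (m - 2 * K) (0 : X d)).image fun y => y + kv
  have hsub : ∀ y ∈ Λ', y ∈ B m (0 : X d) ∧ y + z ∈ B m (0 : X d) := by
    intro y hy
    obtain ⟨y', hy', rfl⟩ := Finset.mem_image.1 hy
    have hb := mem_B_zero_bounds hy'
    have hzK : ∀ μ, ((z μ).natAbs : ℤ) ≤ K := fun μ => by exact_mod_cast natAbs_le_K1 z μ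
    have hmK : ((m - 2 * K : ℕ) : ℤ) = (m : ℤ) - 2 * K := by
      rw [Nat.cast_sub hK]; push_cast; ring
    constructor
    · refine mem_B_zero_of_bounds fun μ => ?_
      have h1 := (hb μ).1; have h2 := (hb μ).2
      rw [hmK] at h2
      show 0 ≤ y' μ + (K : ℤ) ∧ y' μ + (K : ℤ) ≤ m
      constructor <;> omega
    · refine mem_B_zero_of_bounds fun μ => ?_
      have h1 := (hb μ).1; have h2 := (hb μ).2
      rw [hmK] at h2
      have hz := hzK μ
      have hz1 : -(K : ℤ) ≤ z μ ∧ z μ ≤ K := by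
        constructor <;> omega
      show 0 ≤ y' μ + (K : ℤ) + z μ ∧ y' μ + (K : ℤ) + z μ ≤ m
      constructor <;> omega
  have hΛ'sub : Λ' ⊆ B m (0 : X d) := fun y hy => (hsub y hy).1
  have hcard : (Λ'.card : ℝ) = ((m : ℝ) + 1 - 2 * K) ^ d := by
    rw [Finset.card_image_of_injective _ (add_left_injective kv), card_B, Nat.cast_sub hK]
    push_cast
    ring
  unfold cnt
  calc ((m : ℝ) + 1 - 2 * K) ^ d = ∑ _y ∈ Λ', (1 : ℝ) := by
        rw [Finset.sum_const, nsmul_eq_mul, mul_one, hcard]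
    _ = ∑ y ∈ Λ', ind m (y + z) := Finset.sum_congr rfl fun y hy => (ind_of_mem (hsub y hy).2).symm
    _ ≤ ∑ y ∈ B m (0 : X d), ind m (y + z) :=
        Finset.sum_le_sum_of_subset_of_nonneg hΛ'sub fun y _ _ => ind_nonneg m _

/-- **`c_Λ(z)/(m+1)^d → 1`** as `m → ∞`, for every fixed `z`. [folklore] -/
theorem tendsto_cnt_div (z : X d) :
    Tendsto (fun m : ℕ => cnt m z / ((m : ℝ) + 1) ^ d) atTop (𝓝 1) := by
  have hN : Tendsto (fun m : ℕ => (m : ℝ) + 1) atTop atTop :=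
    tendsto_natCast_atTop_atTop.atTop_add tendsto_const_nhds
  have h0 : Tendsto (fun m : ℕ => (2 * (K1 z : ℝ)) / ((m : ℝ) + 1)) atTop (𝓝 0) :=
    tendsto_const_nhds.div_atTop hN
  have hlow : Tendsto (fun m : ℕ => (1 - 2 * (K1 z : ℝ) / ((m : ℝ) + 1)) ^ d) atTop (𝓝 1) := by
    have := (tendsto_const_nhds (x := (1 : ℝ))).sub h0
    simpa using this.pow d
  refine tendsto_of_tendsto_of_tendsto_of_le_of_le' hlow tendsto_const_nhds ?_ ?_
  · filter_upwards [Filter.eventually_ge_atTop (2 * K1 z)] with m hm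
    have hNpos : (0 : ℝ) < (m : ℝ) + 1 := by positivity
    rw [le_div_iff₀ (by positivity), ← mul_pow]
    have : (1 - 2 * (K1 z : ℝ) / ((m : ℝ) + 1)) * ((m : ℝ) + 1) = (m : ℝ) + 1 - 2 * K1 z := by
      field_simp
    rw [this]
    exact cnt_ge m z hm
  · filter_upwards with m
    rw [div_le_one (by positivity)]
    exact cnt_le m z

/-- **`A_m/(m+1)^d → σ(p)`** (Tannery's theorem, dominated by `|κ| ∈ ℓ¹`). [folklore] -/
theorem tendsto_action_pair (n : ℕ) {a : ℝ} (ha : 0 < a) (p : Fin d → ℝ) :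
    Tendsto (fun m : ℕ => (actionForm n a (B m 0) (Cf m p) + actionForm n a (B m 0) (Sf m p))
      / ((m : ℝ) + 1) ^ d) atTop (𝓝 (sigma n a p)) := by
  have hf : ∀ m : ℕ, (actionForm n a (B m 0) (Cf m p) + actionForm n a (B m 0) (Sf m p)) / ((m : ℝ) + 1) ^ d
      = ∑' z : X d, kappa n a z * Real.cos (phase p z) * (cnt m z / ((m : ℝ) + 1) ^ d) := by
    intro m
    rw [action_pair n ha, ← tsum_div_const]
    exact tsum_congr fun z => by ring
  simp_rw [hf]
  unfold sigma
  refine tendsto_tsum_of_dominated_convergence (bound := fun z => |kappa n a z|) (summable_abs_kappa n ha)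
    (fun z => ?_) ?_
  · have := (tendsto_cnt_div (d := d) z).const_mul (kappa n a z * Real.cos (phase p z))
    simpa using this
  · filter_upwards with m
    intro z
    rw [Real.norm_eq_abs, abs_mul]
    calc |kappa n a z * Real.cos (phase p z)| * |cnt m z / ((m : ℝ) + 1) ^ d|
        ≤ |kappa n a z| * 1 := by
          refine mul_le_mul (abs_term_le n a p z) ?_ (abs_nonneg _) (abs_nonneg _)
          rw [abs_of_nonneg (div_nonneg (cnt_nonneg m z) (by positivity))]
          exact (div_le_one (by positivity)).2 (cnt_le m z)
      _ = |kappa n a z| := mul_one _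

/-- **`E_m/(m+1)^d → ω(p)`**. [folklore] -/
theorem tendsto_energy_pair (p : Fin d → ℝ) :
    Tendsto (fun m : ℕ => (energy (Cf m p) + energy (Sf m p)) / ((m : ℝ) + 1) ^ d) atTop (𝓝 (omega p)) := by
  have hf : ∀ m : ℕ, (energy (Cf m p) + energy (Sf m p)) / ((m : ℝ) + 1) ^ d
      = ∑ μ : Fin d, (2 - 2 * Real.cos (p μ) * (cnt m (e μ) / ((m : ℝ) + 1) ^ d)) := by
    intro m
    have hN : ((m : ℝ) + 1) ^ d ≠ 0 := by positivity
    rw [energy_pair, Finset.sum_div]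
    exact Finset.sum_congr rfl fun μ _ => by field_simp
  simp_rw [hf]
  unfold omega
  refine tendsto_finsetSum _ fun μ _ => ?_
  have := ((tendsto_cnt_div (d := d) (e μ)).const_mul (2 * Real.cos (p μ))).const_sub 2
  simpa using this

/-! ## §5  The multiplier bounds: `ω(p) ≤ σ(p) ≤ γ₁(d)·ω(p)` on all of `ℝ^d` [print-located; proved outright] -/

/-- **Bałaban's sentence after (1.66), scalar `ℤ^d` shadow — «The function under the integral is bounded from
below and above by positive constants γ₀, γ₁ dependent on d only»**: the symbol `σ` of the scalar `Δ_k` satisfies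
`ω(p) ≤ σ(p) ≤ γ₁(d)·ω(p)` for EVERY `p ∈ ℝ^d`, with `γ₀ = 1` (node 9) and `γ₁(d) = 2 + 8d²·36^d` (node g8-1),
uniformly in the step `n` and in `a > 0`.  Derived here from the kernel-proved form inequality (1.67) by the
trigonometric test pair and the thermodynamic limit — NOT from (1.66). [cite: Balaban1984PropagatorsI, (1.66)–(1.67) p.29] -/
theorem sigma_bounds (n : ℕ) {a : ℝ} (ha : 0 < a) (p : Fin d → ℝ) :
    omega p ≤ sigma n a p ∧ sigma n a p ≤ gamma1 d * omega p := by
  have hA := tendsto_action_pair n ha p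
  have hE := tendsto_energy_pair (d := d) p
  constructor
  · refine le_of_tendsto_of_tendsto' hE hA fun m => ?_
    exact div_le_div_of_nonneg_right (pair_sandwich n ha m p).1 (by positivity)
  · refine le_of_tendsto_of_tendsto' hA (hE.const_mul (gamma1 d)) fun m => ?_
    rw [← mul_div_assoc]
    exact div_le_div_of_nonneg_right (pair_sandwich n ha m p).2 (by positivity)

/-- `σ ≥ 0`: the scalar `Δ_k` is a positive semi-definite convolution operator at the level of its symbol.
[folklore] -/
theorem sigma_nonneg (n : ℕ) {a : ℝ} (ha : 0 < a) (p : Fin d → ℝ) : 0 ≤ sigma n a p :=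
  le_trans (Finset.sum_nonneg fun μ _ => by linarith [Real.cos_le_one (p μ)]) (sigma_bounds n ha p).1

/-- `σ(p) ≤ 4d·γ₁(d)`: the symbol is bounded (so the scalar `Δ_k` is a bounded operator on `ℓ²(ℤ^d)` at the
symbol level). [folklore] -/
theorem sigma_le (n : ℕ) {a : ℝ} (ha : 0 < a) (p : Fin d → ℝ) : sigma n a p ≤ gamma1 d * (4 * d) := by
  refine (sigma_bounds n ha p).2.trans (mul_le_mul_of_nonneg_left (omega_le p) ?_)
  unfold gamma1; positivity

/-- **`σ(0) = 0`**: the symbol vanishes at zero momentum (both bounds vanish there). [folklore] -/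
theorem sigma_zero (n : ℕ) {a : ℝ} (ha : 0 < a) : sigma n a (0 : Fin d → ℝ) = 0 := by
  have h := sigma_bounds n ha (0 : Fin d → ℝ)
  have h0 : omega (0 : Fin d → ℝ) = 0 := by unfold omega; simp
  rw [h0, mul_zero] at h
  exact le_antisymm h.2 h.1

/-- **Mass sum rule** `Σ'_z κ(z) = 0`, i.e. `Σ'_{z ∈ ℤ^d} (Q′G′Q′*)⁻¹(z, 0) = a`: the scalar `Δ_k` annihilates
constants (in the `ℓ¹`-kernel sense). [folklore] -/
theorem tsum_kappa (n : ℕ) {a : ℝ} (ha : 0 < a) : ∑' z : X d, kappa n a z = 0 := by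
  have h := sigma_zero (d := d) n ha
  unfold sigma at h
  simpa [phase_zero_left] using h

/-- **Mass sum rule, second form**: `Σ'_{z ∈ ℤ^d} (Q′G′Q′*)⁻¹(z, 0) = a`. [folklore] -/
theorem tsum_Kinv_col (n : ℕ) {a : ℝ} (ha : 0 < a) : ∑' z : X d, Kinv n a z 0 = a := by
  have h := tsum_kappa (d := d) n ha
  have hs : Summable fun z : X d => (if z = (0 : X d) then a else 0) := (hasSum_ite_eq (0 : X d) a).summable
  have hK : Summable fun z : X d => Kinv n a z 0 := by
    have := (summable_kappa (d := d) n ha).add hs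
    refine this.congr fun z => ?_
    unfold kappa actionKer
    by_cases hz : z = 0 <;> simp [hz]
  have hsplit : ∑' z : X d, kappa n a z = ∑' z : X d, Kinv n a z 0 - ∑' z : X d, (if z = (0 : X d) then a else 0) := by
    rw [← hK.tsum_sub hs]
    refine tsum_congr fun z => ?_
    unfold kappa actionKer
    by_cases hz : z = 0 <;> simp [hz]
  rw [hsplit, (hasSum_ite_eq (0 : X d) a).tsum_eq] at h
  linarith

/-- The printed shape «∃ γ₀, γ₁ > 0 dependent on d only» for the multiplier of the scalar `Δ_k` on `ℤ^d`, as a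
closed statement over all steps `n`, all `a > 0` and all momenta `p ∈ ℝ^d`.
[cite: Balaban1984PropagatorsI, (1.66)–(1.67) p.29] -/
theorem sigma_bounds_exists (d : ℕ) :
    ∃ γ₀ γ₁ : ℝ, 0 < γ₀ ∧ 0 < γ₁ ∧ ∀ (n : ℕ) (a : ℝ), 0 < a → ∀ p : Fin d → ℝ,
      γ₀ * omega p ≤ sigma n a p ∧ sigma n a p ≤ γ₁ * omega p :=
  ⟨1, gamma1 d, one_pos, by unfold gamma1; positivity, fun n _a ha p => by
    rw [one_mul]; exact sigma_bounds n ha p⟩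

end

end Literature.MathematicalPhysics.QuantumFieldTheory.Balaban1983to89.B5Ineq167SymbolZd
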